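import Summits.ABC.ABC.Theses.DefiniteXi
import Literature.NumberTheory.EllipticCurves.ModularCurve
import Literature.NumberTheory.EllipticCurves.ModularCurveManinConstantProofs
import Literature.NumberTheory.EllipticCurves.DegreeConjectureAbcMurtyProofs
import Literature.NumberTheory.DiophantineGeometry.MinimalDiscriminantProofs
import HarnessLib

/-!
# Route RibetTakahashiSplit — crux `WeightedSzpiroBound` (stmt-ABC-3272), line `two-adic-eisenstein-anchor`:
# stub 2′ `stub_forgivenDegreeBound_of_definiteXi` (reshape of the planner's stub `stub_eisensteinForgivenDegreeBound`)

The planner's stub 2 of this line (`stub_eisensteinForgivenDegreeBound`) was Frey's degree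
conjecture for the Frey curves `E_{a,b} : y² = x(x − a)(x + b)` with the measured sporadic `2`-adic
excess forgiven: for every `ε > 0` some `C` with, for every MINIMAL datum `D` at level `N = N_E`,
`deg D / 2^{(v₂(deg D) − e₂(N))⁺} ≤ C · (D.c)² · N^{2+ε} · |Δ_min|^ε`
(`e₂(N) = Σ_{p ∣ N, p odd} v₂(p² − 1)`; truncated subtraction and division in `ℕ`).  Wave 1 of the
line returned `stub-blocked: DefiniteXi.XiStrongBound` for it (ABC-strength, no lever in this card),
and the lead RESHAPED it into the registered stub 2′ proved here (skeleton
`Cruxes/WeightedSzpiroBound/Lines/two-adic-eisenstein-anchor.lean`, namespace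
`Summit.ABC.ABC.Theorems.TwoAdicEisensteinAnchor`):
`stub_forgivenDegreeBound_of_definiteXi : DefiniteXi.XiStrongBound → DefiniteXi.DefiniteRTControlPrime →`
(the forgiven bound above) — i.e. the service of this stub by route `DefiniteXi`'s registered items
made explicit, the composition `WeightedSzpiroBound_of` taking those two items as hypotheses next to
`FreyModularity` and `PeterssonLowerBound`.

## (A) Formalisation-artefact check (short; nothing cheap either way)

* No cheap unconditional proof.  `ModularParametrizationData W N` (ModularCurve.lean:291) is an
  honest hypothesis structure: `f` is a genuine Mathlib `CuspForm (Γ₀(N)) 2` tied to `W` by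
  `IsNewformOf` (`IsNewform0 f ∧ aₙ(f) = aₙ(W)`, CuspFormLFunction.lean:325), `uniformize : ℂ →+ E(ℂ)`
  is onto with kernel the lattice of `L`, `eichlerIntegral f τ = 2π ∫₀^∞ f(τ + it) dt` is a genuine
  Bochner integral (ModularSymbols.lean:115, no junk branch), and `deg` is pinned by `deg_spec` to
  the generic number of `Γ₀(N)`-orbits in the fibres of `φ = uniformize (c · ∫ f)`.  So for a
  MINIMAL datum `D.deg` is the true minimal modular degree of this model (data with Manin constant
  `k · c₀` have degree `k² · deg₀`; the minimal one is the generator) — the stub is genuinely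
  Frey's degree conjecture up to the forgiven `2`-part, i.e. ABC-strength (Murty 1999 Thm 1 ⟹;
  Masser 1990: exponent `2` sharp).  No degeneracy is derivable from `conductorNorm = N` either
  (`level_eq_conductorNorm` is itself a named fact, Carayol).
* No cheap refutation.  No datum is constructible in the tree (modularity in datum form is the open
  item `DefiniteXi.FreyModularity`, stmt-ABC-11340), so neither emptiness (which would make the stub
  vacuously true with `C = 0`) nor a large-degree witness is available; and minimality makes `D.deg`
  a function of `(a, b)` alone (`deg_le_sInf` below), so no artefact inflates it.
* Verdict for the planner's stub 2: `stub-blocked` on `Summit.ABC.ABC.Theses.DefiniteXi.XiStrongBound` (stmt-ABC-11337, open,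
  ABC-strength) `+ DefiniteRTControlPrime` (stmt-ABC-11338, known in print, open in tree).

## (B) What this file proves (rc 0, no sorry)

* `eisensteinForgivenDegreeBound_of_minimalDegreeBound` — (i): the bound `deg D ≤ C N^{2+ε}` for
  minimal data implies the registered statement verbatim (`deg / 2^k ≤ deg`, `1 ≤ c²` as
  `c ∈ ℤ ∖ {0}` by `maninConstant_ne_zero_holds`, `1 ≤ |Δ_min|^ε` by
  `minimalDiscriminantNorm_pos_holds`, `C ↦ max C 0`).
* `eisensteinForgivenDegreeBound_of_definiteXi` — (ii): from the three route-`DefiniteXi` items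
  `XiStrongBound`, `DefiniteRTControlPrime`, `DefiniteGlue`.
* `definiteGlue_holds` — (iii): the item `DefiniteXi.DefiniteGlue` (stmt-ABC-11341) PROVED, by the
  plan of its docstring (one odd prime `q ∣ N` as `N⁻`; if `N` is a power of two then
  `rad|ab(a+b)| ∣ 2N` forces `|a|, |b| ≤ 2`, and the minimal degree of those finitely many curves is
  a function of the pair — an `sInf`, no definition — absorbed into `C` as a finite sum).
* `stub_forgivenDegreeBound_of_definiteXi` — (ii)+(iii): THE REGISTERED STUB 2′ — the forgiven bound
  from the two remaining open items `XiStrongBound ∧ DefiniteRTControlPrime` alone.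
-/

-- Summit.<Summit>.<Problem> is the mandated namespace; for the single-conjunct summit ABC the duplicate ABC.ABC is deliberate.
set_option linter.dupNamespace false

noncomputable section

namespace Summit.ABC.ABC.Theorems.TwoAdicEisensteinAnchor

open Literature.NumberTheory
open Literature.NumberTheory.EllipticCurves
open Literature.NumberTheory.EllipticCurves.ModularForms
open UniqueFactorizationMonoid

/-! ## (i) The stub from the plain minimal-degree bound -/

/-- **Reduction (i).**  If every minimal-degree datum `D` of a Frey curve at its conductor level
satisfies `deg D ≤ C_ε N^{2+ε}`, then the registered stub `stub_eisensteinForgivenDegreeBound`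
holds: `deg D / 2^{(v₂(deg D) − e₂(N))⁺} ≤ deg D` (`Nat.div_le_self`), `1 ≤ (D.c)²` because the
Manin constant is a non-zero integer (`maninConstant_ne_zero_holds`), and `1 ≤ |Δ_min|^ε` because
`|Δ_min| ≥ 1` (`minimalDiscriminantNorm_pos_holds`); the constant becomes `max C 0`. [folklore] -/
theorem eisensteinForgivenDegreeBound_of_minimalDegreeBound
    (h : ∀ ε : ℝ, 0 < ε → ∃ C : ℝ, ∀ a b : ℤ, IsCoprime a b → a * b * (a + b) ≠ 0 →
      ∀ (N : ℕ) [NeZero N],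
        (Literature.NumberTheory.EllipticCurves.freyCurve a b).conductorNorm ℤ = N →
        ∀ D : Literature.NumberTheory.EllipticCurves.ModularForms.ModularParametrizationData
            (Literature.NumberTheory.EllipticCurves.freyCurve a b) N,
          (∀ D' : Literature.NumberTheory.EllipticCurves.ModularForms.ModularParametrizationData
              (Literature.NumberTheory.EllipticCurves.freyCurve a b) N, D.deg ≤ D'.deg) →
            (D.deg : ℝ) ≤ C * (N : ℝ) ^ (2 + ε)) :
    ∀ ε : ℝ, 0 < ε → ∃ C : ℝ, ∀ a b : ℤ, IsCoprime a b → a * b * (a + b) ≠ 0 →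
      ∀ (N : ℕ) [NeZero N],
        (Literature.NumberTheory.EllipticCurves.freyCurve a b).conductorNorm ℤ = N →
        ∀ D : Literature.NumberTheory.EllipticCurves.ModularForms.ModularParametrizationData
            (Literature.NumberTheory.EllipticCurves.freyCurve a b) N,
          (∀ D' : Literature.NumberTheory.EllipticCurves.ModularForms.ModularParametrizationData
              (Literature.NumberTheory.EllipticCurves.freyCurve a b) N, D.deg ≤ D'.deg) →
            ((D.deg / 2 ^ (padicValNat 2 D.deg -
                ∑ p ∈ N.primeFactors.erase 2, padicValNat 2 (p ^ 2 - 1)) : ℕ) : ℝ) ≤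
              C * (D.c : ℝ) ^ 2 * (N : ℝ) ^ (2 + ε) *
                (((Literature.NumberTheory.EllipticCurves.freyCurve a b).minimalDiscriminantNorm ℤ
                    : ℕ) : ℝ) ^ ε := by
  intro ε hε
  obtain ⟨C, hC⟩ := h ε hε
  refine ⟨max C 0, fun a b hab h0 N _ hN D hmin ↦ ?_⟩
  have h1 := hC a b hab h0 N hN D hmin
  -- the three trivial factors
  have hc : D.c ≠ 0 := D.maninConstant_ne_zero_holds
  have hc1 : (1 : ℝ) ≤ (D.c : ℝ) ^ 2 := by
    have h' : (1 : ℤ) ≤ D.c ^ 2 := by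
      rw [← sq_abs]
      exact one_le_pow₀ (Int.one_le_abs hc)
    exact_mod_cast h'
  have hΔ1 : (1 : ℝ) ≤ (((freyCurve a b).minimalDiscriminantNorm ℤ : ℕ) : ℝ) :=
    Nat.one_le_cast.mpr (WeierstrassCurve.minimalDiscriminantNorm_pos_holds (freyCurve a b))
  have hΔε : (1 : ℝ) ≤ (((freyCurve a b).minimalDiscriminantNorm ℤ : ℕ) : ℝ) ^ ε :=
    Real.one_le_rpow hΔ1 hε.le
  have hNpow : (0 : ℝ) ≤ (N : ℝ) ^ (2 + ε) := Real.rpow_nonneg (Nat.cast_nonneg N) _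
  have hdiv : ((D.deg / 2 ^ (padicValNat 2 D.deg -
      ∑ p ∈ N.primeFactors.erase 2, padicValNat 2 (p ^ 2 - 1)) : ℕ) : ℝ) ≤ (D.deg : ℝ) :=
    Nat.cast_le.mpr (Nat.div_le_self _ _)
  have hK : (0 : ℝ) ≤ max C 0 * (N : ℝ) ^ (2 + ε) := mul_nonneg (le_max_right _ _) hNpow
  calc ((D.deg / 2 ^ (padicValNat 2 D.deg -
        ∑ p ∈ N.primeFactors.erase 2, padicValNat 2 (p ^ 2 - 1)) : ℕ) : ℝ)
      ≤ (D.deg : ℝ) := hdiv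
    _ ≤ C * (N : ℝ) ^ (2 + ε) := h1
    _ ≤ max C 0 * (N : ℝ) ^ (2 + ε) := mul_le_mul_of_nonneg_right (le_max_left _ _) hNpow
    _ = (max C 0 * (N : ℝ) ^ (2 + ε)) * 1 * 1 := by ring
    _ ≤ (max C 0 * (N : ℝ) ^ (2 + ε)) * (D.c : ℝ) ^ 2 *
          (((freyCurve a b).minimalDiscriminantNorm ℤ : ℕ) : ℝ) ^ ε :=
        mul_le_mul (mul_le_mul_of_nonneg_left hc1 hK) hΔε zero_le_one
          (mul_nonneg hK (sq_nonneg _))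
    _ = max C 0 * (D.c : ℝ) ^ 2 * (N : ℝ) ^ (2 + ε) *
          (((freyCurve a b).minimalDiscriminantNorm ℤ : ℕ) : ℝ) ^ ε := by ring

/-! ## (ii) The stub from route `DefiniteXi`'s three items -/

/-- **Reduction (ii).**  Route `DefiniteXi`'s items `XiStrongBound` (stmt-ABC-11337, the open
ABC-strength crux), `DefiniteRTControlPrime` (stmt-ABC-11338, the definite Ribet–Takahashi
comparison, known in print) and the glue `DefiniteGlue` (stmt-ABC-11341) give the minimal-degree
bound `deg D ≤ C_ε N^{2+ε}`, hence the stub by reduction (i). [folklore] -/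
theorem eisensteinForgivenDegreeBound_of_definiteXi
    (hXS : Summit.ABC.ABC.Theses.DefiniteXi.XiStrongBound)
    (hRT : Summit.ABC.ABC.Theses.DefiniteXi.DefiniteRTControlPrime)
    (hG : Summit.ABC.ABC.Theses.DefiniteXi.DefiniteGlue) :
    ∀ ε : ℝ, 0 < ε → ∃ C : ℝ, ∀ a b : ℤ, IsCoprime a b → a * b * (a + b) ≠ 0 →
      ∀ (N : ℕ) [NeZero N],
        (Literature.NumberTheory.EllipticCurves.freyCurve a b).conductorNorm ℤ = N →
        ∀ D : Literature.NumberTheory.EllipticCurves.ModularForms.ModularParametrizationData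
            (Literature.NumberTheory.EllipticCurves.freyCurve a b) N,
          (∀ D' : Literature.NumberTheory.EllipticCurves.ModularForms.ModularParametrizationData
              (Literature.NumberTheory.EllipticCurves.freyCurve a b) N, D.deg ≤ D'.deg) →
            ((D.deg / 2 ^ (padicValNat 2 D.deg -
                ∑ p ∈ N.primeFactors.erase 2, padicValNat 2 (p ^ 2 - 1)) : ℕ) : ℝ) ≤
              C * (D.c : ℝ) ^ 2 * (N : ℝ) ^ (2 + ε) *
                (((Literature.NumberTheory.EllipticCurves.freyCurve a b).minimalDiscriminantNorm ℤ
                    : ℕ) : ℝ) ^ ε :=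
  eisensteinForgivenDegreeBound_of_minimalDegreeBound (hG hXS hRT)

/-! ## (iii) The glue item `DefiniteXi.DefiniteGlue` (stmt-ABC-11341), proved -/

/-- A minimal-degree datum at the conductor level has degree `≤` the infimum of all degrees of data
of that curve at its conductor level (in fact `=`; the infimum is a function of the pair `(a, b)`
alone): the level carrying data with `conductorNorm = N` is unique, and `D` is minimal there.
[folklore] -/
private theorem deg_le_sInf {a b : ℤ} {N : ℕ} [NeZero N]
    (hN : (freyCurve a b).conductorNorm ℤ = N) (D : ModularParametrizationData (freyCurve a b) N)
    (hmin : ∀ D' : ModularParametrizationData (freyCurve a b) N, D.deg ≤ D'.deg) :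
    D.deg ≤ sInf {d : ℕ | ∃ (M : ℕ) (_ : NeZero M), (freyCurve a b).conductorNorm ℤ = M ∧
      ∃ D₀ : ModularParametrizationData (freyCurve a b) M, D₀.deg = d} := by
  have hmem : D.deg ∈ {d : ℕ | ∃ (M : ℕ) (_ : NeZero M), (freyCurve a b).conductorNorm ℤ = M ∧
      ∃ D₀ : ModularParametrizationData (freyCurve a b) M, D₀.deg = d} := ⟨N, ‹_›, hN, D, rfl⟩
  obtain ⟨N', _, hN', D', hD'⟩ := Nat.sInf_mem ⟨_, hmem⟩
  obtain rfl : N' = N := hN'.symm.trans hN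
  exact (hmin D').trans hD'.le

/-- If no odd prime divides the conductor `N` of `E_{a,b}` (`a, b` coprime, `ab(a+b) ≠ 0`), then
every prime factor of `ab(a+b)` is `2`, by `rad|ab(a+b)| ∣ 2N`
(`radical_natAbs_dvd_two_mul_conductorNorm_freyCurve`, Bombieri–Gubler Ex. 12.5.10). [folklore] -/
private theorem prime_eq_two_of_dvd {a b : ℤ} (hab : IsCoprime a b) (h0 : a * b * (a + b) ≠ 0)
    {N : ℕ} [NeZero N] (hN : (freyCurve a b).conductorNorm ℤ = N)
    (hno : ∀ q : ℕ, q.Prime → q ∣ N → q = 2) :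
    ∀ p : ℕ, p.Prime → p ∣ (a * b * (a + b)).natAbs → p = 2 := by
  intro p hp hpd
  have hrad := radical_natAbs_dvd_two_mul_conductorNorm_freyCurve hab h0
  rw [hN] at hrad
  have h2N : 2 * N ≠ 0 := mul_ne_zero two_ne_zero (NeZero.ne N)
  have hm0 : (a * b * (a + b)).natAbs ≠ 0 := Int.natAbs_ne_zero.mpr h0
  have hsub := (Nat.radical_dvd_iff h2N).mp hrad
  have hp2N : p ∣ 2 * N :=
    Nat.dvd_of_mem_primeFactors (hsub (Nat.mem_primeFactors.mpr ⟨hp, hpd, hm0⟩))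
  rcases (Nat.Prime.dvd_mul hp).mp hp2N with h | h
  · exact (Nat.prime_dvd_prime_iff_eq hp Nat.prime_two).mp h
  · exact hno p hp h

/-- Coprime `a, b` all of whose prime factors of `ab(a+b)` are `2` satisfy `|a|, |b| ≤ 2`:
an odd divisor of `ab(a+b)` is `±1`, and `a, b` are not both even; so either `|a| = |b| = 1`, or
one of them and `a + b` are `±1`. (The six pairs `(±1,±1)`, `(1,−2)`, `(−2,1)`, `(2,−1)`, `(−1,2)`.)
[folklore] -/
private theorem natAbs_le_two {a b : ℤ} (hab : IsCoprime a b)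
    (h2 : ∀ p : ℕ, p.Prime → p ∣ (a * b * (a + b)).natAbs → p = 2) :
    a.natAbs ≤ 2 ∧ b.natAbs ≤ 2 := by
  -- an odd divisor of `ab(a+b)` is `±1`
  have key : ∀ x : ℤ, x ∣ a * b * (a + b) → ¬ (2 : ℤ) ∣ x → x.natAbs = 1 := by
    intro x hx hodd
    by_contra hne
    have hp := Nat.minFac_prime hne
    have hdvd : x.natAbs.minFac ∣ (a * b * (a + b)).natAbs :=
      (Nat.minFac_dvd _).trans (Int.natAbs_dvd_natAbs.mpr hx)
    have h2x : x.natAbs.minFac = 2 := h2 _ hp hdvd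
    have h2x' : (2 : ℕ) ∣ x.natAbs := h2x ▸ Nat.minFac_dvd _
    exact hodd (by omega)
  -- `a`, `b` are not both even
  have hnot : ¬ ((2 : ℤ) ∣ a ∧ (2 : ℤ) ∣ b) := by
    rintro ⟨h2a, h2b⟩
    rcases Int.isUnit_iff.mp (hab.isUnit_of_dvd' h2a h2b) with h | h <;> omega
  have hda : a ∣ a * b * (a + b) := ⟨b * (a + b), by ring⟩
  have hdb : b ∣ a * b * (a + b) := ⟨a * (a + b), by ring⟩
  have hdab : (a + b) ∣ a * b * (a + b) := ⟨a * b, by ring⟩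
  by_cases h2a : (2 : ℤ) ∣ a
  · have h2b : ¬ (2 : ℤ) ∣ b := fun h ↦ hnot ⟨h2a, h⟩
    have hb1 := key b hdb h2b
    have hab1 := key (a + b) hdab (by omega)
    omega
  · have ha1 := key a hda h2a
    by_cases h2b : (2 : ℤ) ∣ b
    · have hab1 := key (a + b) hdab (by omega)
      omega
    · have hb1 := key b hdb h2b
      omega

/-- **Reduction (iii): the glue `DefiniteXi.DefiniteGlue` (item stmt-ABC-11341) holds.**
`XiStrongBound → DefiniteRTControlPrime →` (for every `ε > 0` some `C` with `deg D ≤ C N^{2+ε}`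
for every minimal-degree datum `D` of `E_{a,b}` at its conductor level `N`).  Proof (the item's
own plan): fix `ε`, take `C₁` from `XiStrongBound` at `ε/2` and `C₂` from `DefiniteRTControlPrime`
at `ε/2`.  If an ODD prime `q ∣ N`, use `N⁻ := q` (odd, squarefree, `q.primeFactors = {q}` of odd
cardinality `1`): `deg D ≤ C₂ N^{ε/2} · ξ(N/q,q) · v_q(Δ_min) ≤ max(C₂,0) · max(C₁,0) · N^{2+ε}`
(`ξ · v_q ≥ 0` is a cast natural number).  If NO odd prime divides `N`, `rad|ab(a+b)| ∣ 2N`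
(`radical_natAbs_dvd_two_mul_conductorNorm_freyCurve`) makes every prime factor of `ab(a+b)` equal
to `2`, whence `|a|, |b| ≤ 2` (`natAbs_le_two`); a minimal datum has `deg D ≤ minDeg a b`, a
function of the pair alone (`deg_le_sInf`), so these finitely many curves are absorbed by the
finite sum `Σ_{|a|,|b| ≤ 2} minDeg a b` added to the constant (`N^{2+ε} ≥ 1`). [folklore] -/
theorem definiteGlue_holds : Summit.ABC.ABC.Theses.DefiniteXi.DefiniteGlue := by
  intro hXS hRT ε hε
  have hε2 : 0 < ε / 2 := by positivity
  obtain ⟨C₁, hC₁⟩ := hXS (ε / 2) hε2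
  obtain ⟨C₂, hC₂⟩ := hRT (ε / 2) hε2
  -- the finitely many curves whose conductor is a power of two are absorbed here
  -- `minDeg a b` = the least degree of a datum of `E_{a,b}` at its conductor level (a function of the pair)
  set minDeg : ℤ → ℤ → ℕ := (fun a b : ℤ ↦ sInf {d : ℕ | ∃ (M : ℕ) (_ : NeZero M), (freyCurve a b).conductorNorm ℤ = M ∧
      ∃ D₀ : ModularParametrizationData (freyCurve a b) M, D₀.deg = d}) with hminDeg
  refine ⟨max C₂ 0 * max C₁ 0 +
    ((∑ a ∈ Finset.Icc (-2 : ℤ) 2, ∑ b ∈ Finset.Icc (-2 : ℤ) 2, minDeg a b : ℕ) : ℝ),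
    fun a b hab h0 N _ hN D hmin ↦ ?_⟩
  set Cfin : ℕ := ∑ a ∈ Finset.Icc (-2 : ℤ) 2, ∑ b ∈ Finset.Icc (-2 : ℤ) 2, minDeg a b with hCfin
  have hN1 : (1 : ℝ) ≤ (N : ℝ) := Nat.one_le_cast.mpr (Nat.one_le_iff_ne_zero.mpr (NeZero.ne N))
  have hN0 : (0 : ℝ) ≤ (N : ℝ) := Nat.cast_nonneg N
  have hNpos : (0 : ℝ) < (N : ℝ) := one_pos.trans_le hN1
  have hNpow1 : (1 : ℝ) ≤ (N : ℝ) ^ (2 + ε) := Real.one_le_rpow hN1 (by linarith)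
  have hNpow0 : (0 : ℝ) ≤ (N : ℝ) ^ (2 + ε) := zero_le_one.trans hNpow1
  have hK0 : (0 : ℝ) ≤ max C₂ 0 * max C₁ 0 := mul_nonneg (le_max_right _ _) (le_max_right _ _)
  have hCfin0 : (0 : ℝ) ≤ (Cfin : ℝ) := Nat.cast_nonneg _
  have hKN : (0 : ℝ) ≤ max C₂ 0 * max C₁ 0 * (N : ℝ) ^ (2 + ε) := mul_nonneg hK0 hNpow0
  have hCN : (0 : ℝ) ≤ (Cfin : ℝ) * (N : ℝ) ^ (2 + ε) := mul_nonneg hCfin0 hNpow0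
  by_cases hodd : ∃ q : ℕ, q.Prime ∧ q ≠ 2 ∧ q ∣ N
  · -- MAIN CASE: an odd prime `q ∣ N`; take `N⁻ := q`
    obtain ⟨q, hq, hq2, hqN⟩ := hodd
    have h1 := hC₂ a b hab h0 N hN q hq hq2 hqN D hmin
    have h2 := hC₁ a b hab h0 N hN q (hq.odd_of_ne_two hq2) hq.prime.squarefree
      (by rw [hq.primeFactors, Finset.card_singleton]; exact odd_one) hqN
    rw [hq.primeFactors, Finset.prod_singleton] at h2
    have hNε : (0 : ℝ) ≤ (N : ℝ) ^ (ε / 2) := Real.rpow_nonneg hN0 _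
    have hsplit : (N : ℝ) ^ (ε / 2) * (N : ℝ) ^ (2 + ε / 2) = (N : ℝ) ^ (2 + ε) := by
      rw [← Real.rpow_add hNpos]
      congr 1
      ring
    -- generic bookkeeping in the quantity `X = ξ(N/q,q) · v_q(Δ_min) ≥ 0`
    have key : ∀ X : ℝ, 0 ≤ X → (D.deg : ℝ) ≤ C₂ * (N : ℝ) ^ (ε / 2) * X →
        X ≤ C₁ * (N : ℝ) ^ (2 + ε / 2) →
        (D.deg : ℝ) ≤ (max C₂ 0 * max C₁ 0 + (Cfin : ℝ)) * (N : ℝ) ^ (2 + ε) := by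
      intro X hX0 h1 h2
      calc (D.deg : ℝ) ≤ C₂ * (N : ℝ) ^ (ε / 2) * X := h1
        _ ≤ max C₂ 0 * (N : ℝ) ^ (ε / 2) * X :=
            mul_le_mul_of_nonneg_right (mul_le_mul_of_nonneg_right (le_max_left _ _) hNε) hX0
        _ ≤ max C₂ 0 * (N : ℝ) ^ (ε / 2) * (max C₁ 0 * (N : ℝ) ^ (2 + ε / 2)) := by
            refine mul_le_mul_of_nonneg_left ?_ (mul_nonneg (le_max_right _ _) hNε)
            exact h2.trans
              (mul_le_mul_of_nonneg_right (le_max_left _ _) (Real.rpow_nonneg hN0 _))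
        _ = max C₂ 0 * max C₁ 0 * ((N : ℝ) ^ (ε / 2) * (N : ℝ) ^ (2 + ε / 2)) := by ring
        _ = max C₂ 0 * max C₁ 0 * (N : ℝ) ^ (2 + ε) := by rw [hsplit]
        _ ≤ (max C₂ 0 * max C₁ 0 + (Cfin : ℝ)) * (N : ℝ) ^ (2 + ε) := by linarith
    exact key _ (by positivity) h1 h2
  · -- DEGENERATE CASE: `N` is a power of two; `|a|, |b| ≤ 2`
    push Not at hodd
    have hno : ∀ q : ℕ, q.Prime → q ∣ N → q = 2 := fun q hq hqN ↦ by
      by_contra hq2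
      exact hodd q hq hq2 hqN
    obtain ⟨ha, hb⟩ := natAbs_le_two hab (prime_eq_two_of_dvd hab h0 hN hno)
    have hdeg : D.deg ≤ minDeg a b := by rw [hminDeg]; exact deg_le_sInf hN D hmin
    have hmem_a : a ∈ Finset.Icc (-2 : ℤ) 2 := by rw [Finset.mem_Icc]; omega
    have hmem_b : b ∈ Finset.Icc (-2 : ℤ) 2 := by rw [Finset.mem_Icc]; omega
    have hfin : minDeg a b ≤ Cfin := by
      calc minDeg a b ≤ ∑ b' ∈ Finset.Icc (-2 : ℤ) 2, minDeg a b' :=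
            Finset.single_le_sum (f := fun b' ↦ minDeg a b') (fun _ _ ↦ Nat.zero_le _) hmem_b
        _ ≤ Cfin :=
            Finset.single_le_sum (f := fun a' ↦ ∑ b' ∈ Finset.Icc (-2 : ℤ) 2, minDeg a' b')
              (fun _ _ ↦ Nat.zero_le _) hmem_a
    have hdegR : (D.deg : ℝ) ≤ (Cfin : ℝ) := by exact_mod_cast hdeg.trans hfin
    calc (D.deg : ℝ) ≤ (Cfin : ℝ) := hdegR
      _ ≤ (Cfin : ℝ) * (N : ℝ) ^ (2 + ε) := le_mul_of_one_le_right hCfin0 hNpow1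
      _ ≤ (max C₂ 0 * max C₁ 0 + (Cfin : ℝ)) * (N : ℝ) ^ (2 + ε) := by linarith

/-! ## (ii)+(iii) The stub from the two remaining open items of route `DefiniteXi` -/

/-- **The registered stub 2′ of the line (`stub_forgivenDegreeBound_of_definiteXi`).**  The
planner's stub `stub_eisensteinForgivenDegreeBound` (the forgiven degree bound) follows from route
`DefiniteXi`'s crux `XiStrongBound` (stmt-ABC-11337, open, ABC-strength) and its support
`DefiniteRTControlPrime` (stmt-ABC-11338, Takahashi 2001 Thm 2.3/3.8 + Pasten Thm 6.1, known in
print, open in the tree) ALONE, the glue being `definiteGlue_holds`. [folklore] -/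
theorem stub_forgivenDegreeBound_of_definiteXi :
    Summit.ABC.ABC.Theses.DefiniteXi.XiStrongBound →
    Summit.ABC.ABC.Theses.DefiniteXi.DefiniteRTControlPrime →
    ∀ ε : ℝ, 0 < ε → ∃ C : ℝ, ∀ a b : ℤ, IsCoprime a b → a * b * (a + b) ≠ 0 →
      ∀ (N : ℕ) [NeZero N],
        (Literature.NumberTheory.EllipticCurves.freyCurve a b).conductorNorm ℤ = N →
        ∀ D : Literature.NumberTheory.EllipticCurves.ModularForms.ModularParametrizationData
            (Literature.NumberTheory.EllipticCurves.freyCurve a b) N,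
          (∀ D' : Literature.NumberTheory.EllipticCurves.ModularForms.ModularParametrizationData
              (Literature.NumberTheory.EllipticCurves.freyCurve a b) N, D.deg ≤ D'.deg) →
            ((D.deg / 2 ^ (padicValNat 2 D.deg -
                ∑ p ∈ N.primeFactors.erase 2, padicValNat 2 (p ^ 2 - 1)) : ℕ) : ℝ) ≤
              C * (D.c : ℝ) ^ 2 * (N : ℝ) ^ (2 + ε) *
                (((Literature.NumberTheory.EllipticCurves.freyCurve a b).minimalDiscriminantNorm ℤ
                    : ℕ) : ℝ) ^ ε := fun hXS hRT ↦
  eisensteinForgivenDegreeBound_of_definiteXi hXS hRT definiteGlue_holds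

end Summit.ABC.ABC.Theorems.TwoAdicEisensteinAnchor

end
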